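import Mathlib.Data.Real.Basic
import Mathlib.Algebra.Module.Basic
import Mathlib.Data.Fintype.Basic
import Mathlib.Data.Finset.Max
import Mathlib.Data.Finset.Card
import Mathlib.Tactic.Linarith
import Mathlib.Tactic.FieldSimp
import Mathlib.Tactic.Ring
import HarnessLib

/-!
# `NoHeavyLowerTail` (crux stmt-CriticalPhenomena-4575), Sahi programme P4 — SEGMENT INDUCTION: a function that is affine along enough
# directions is nonnegative on a basic semialgebraic set as soon as it is nonnegative at the RIGID points

Support file (cell `prim-l12`, seat P4, generation 37; `--supports stmt-CriticalPhenomena-4575`).  No definitions, no named facts, no sorries.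

Abstract lemma behind the rigid-point reduction of the three-member OR step (seat memo of generation 37): let `K = {m : ∀ i, 0 ≤ r i m}` for
finitely many functions `r i : V → ℝ` on a real vector space and `Φ : V → ℝ`.  Call `m ∈ K` MOVABLE if there is a direction `d` along which
all `r i` and `Φ` are affine, every row tight at `m` has zero slope, and some row strictly decreases in each of the directions `±d` (so the
line leaves `K` both ways).  Then `m` lies in the relative interior of a segment of `K` whose endpoints have strictly more tight rows, and
`Φ(m)` is a convex combination of the endpoint values.  Hence, by strong induction on the number of slack rows: if `Φ ≥ 0` at every
non-movable ("rigid") point of `K`, then `Φ ≥ 0` on `K`.  No compactness, no LP duality.  In the application `V = ℝ⁷` (hold moments of a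
three-member block), the rows are the Venn/Harris/Sahi rows of the block, the directions are the four coordinate slicings along which the
multi-affine functional `E₄(a₀∨b₀,a₁∨b₁,a₂∨b₂,a₃)` is affine, and the rigid points form eight explicit families. [this work]
-/

namespace Summit.CriticalPhenomena.PercolationContinuityZ3.Theorems.SahiE4UnionSegment

open Finset

variable {V : Type*} [AddCommGroup V] [Module ℝ V] {ι : Type*} [Fintype ι]

/-- One forward step: along a direction `d` on which all rows are affine, tight rows have zero slope and some row strictly decreases,
there is `t > 0` such that `m + t • d` still satisfies all rows and has strictly fewer slack rows. [this work] -/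
theorem exists_step [DecidableEq ι] (r : ι → V → ℝ) (m d : V) (hm : ∀ i, 0 ≤ r i m)
    (haff : ∀ i (t : ℝ), r i (m + t • d) = r i m + t * (r i (m + d) - r i m))
    (htight : ∀ i, r i m = 0 → r i (m + d) = r i m)
    (hdec : ∃ i, r i (m + d) < r i m) :
    ∃ t : ℝ, 0 < t ∧ (∀ i, 0 ≤ r i (m + t • d)) ∧
      (univ.filter fun i => r i (m + t • d) ≠ 0).card < (univ.filter fun i => r i m ≠ 0).card := by
  classical
  set c : ι → ℝ := fun i => r i (m + d) - r i m with hc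
  set I := univ.filter fun i => c i < 0 with hI
  obtain ⟨i₁, hi₁⟩ := hdec
  have hIne : I.Nonempty := ⟨i₁, by simp [hI, hc]; linarith⟩
  obtain ⟨j, hjI, hjmin⟩ := exists_min_image I (fun i => r i m / (-(c i))) hIne
  have hcj : c j < 0 := by simpa [hI] using hjI
  have hrj : 0 < r j m := by
    rcases lt_or_eq_of_le (hm j) with h | h
    · exact h
    · exfalso
      have := htight j h.symm
      simp [hc] at hcj
      linarith
  set t := r j m / (-(c j)) with ht
  have htpos : 0 < t := div_pos hrj (by linarith)
  refine ⟨t, htpos, ?_, ?_⟩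
  · intro i
    rw [haff]
    by_cases hci : c i < 0
    · have hle : t ≤ r i m / (-(c i)) := hjmin i (by simp [hI, hci])
      have hnci : 0 < -(c i) := by linarith
      have : t * (-(c i)) ≤ r i m := by
        have := (le_div_iff₀ hnci).mp hle
        linarith
      show 0 ≤ r i m + t * c i
      nlinarith
    · have hci' : 0 ≤ c i := not_lt.mp hci
      show 0 ≤ r i m + t * c i
      have := hm i
      nlinarith
  · apply card_lt_card
    rw [ssubset_iff_of_subset]
    · refine ⟨j, by simp [hrj.ne'], ?_⟩
      simp only [mem_filter, mem_univ, true_and, not_not]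
      rw [haff]
      show r j m + t * c j = 0
      rw [ht]
      have hcj0 : c j ≠ 0 := hcj.ne
      field_simp
      ring
    · intro i hi
      simp only [mem_filter, mem_univ, true_and] at hi ⊢
      intro h0
      apply hi
      rw [haff, h0, htight i h0, h0]
      ring

/-- **Segment induction.**  If every point of `K = {∀ i, 0 ≤ r i m}` is either `Rigid` or admits a direction `d` along which all rows and
`Φ` are affine, tight rows have zero slope, and some row strictly decreases in each of the directions `d` and `−d`, and if `Φ ≥ 0` at every
rigid point of `K`, then `Φ ≥ 0` on `K`. [this work] -/
theorem nonneg_of_rigid (r : ι → V → ℝ) (Φ : V → ℝ) (Rigid : V → Prop)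
    (hstep : ∀ m, (∀ i, 0 ≤ r i m) → ¬ Rigid m →
      ∃ d : V, (∀ i (t : ℝ), r i (m + t • d) = r i m + t * (r i (m + d) - r i m)) ∧
        (∀ t : ℝ, Φ (m + t • d) = Φ m + t * (Φ (m + d) - Φ m)) ∧
        (∀ i, r i m = 0 → r i (m + d) = r i m) ∧
        (∃ i, r i (m + d) < r i m) ∧ (∃ i, r i m < r i (m + d)))
    (hbase : ∀ m, (∀ i, 0 ≤ r i m) → Rigid m → 0 ≤ Φ m) :
    ∀ m, (∀ i, 0 ≤ r i m) → 0 ≤ Φ m := by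
  classical
  suffices H : ∀ n : ℕ, ∀ m, (univ.filter fun i => r i m ≠ 0).card = n → (∀ i, 0 ≤ r i m) → 0 ≤ Φ m from
    fun m hm => H _ m rfl hm
  intro n
  induction n using Nat.strong_induction_on with
  | _ n ih =>
    intro m hn hm
    by_cases hR : Rigid m
    · exact hbase m hm hR
    obtain ⟨d, haff, hΦ, htight, hdec, hinc⟩ := hstep m hm hR
    -- forward step along d
    obtain ⟨t₁, ht₁, hm₁, hcard₁⟩ := exists_step r m d hm haff htight hdec
    -- backward step along -d
    have haff' : ∀ i (t : ℝ), r i (m + t • (-d)) = r i m + t * (r i (m + -d) - r i m) := by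
      intro i t
      have h1 := haff i (-t)
      have h2 := haff i (-1)
      simp only [neg_smul, one_smul] at h2
      rw [smul_neg, ← neg_smul, h1, h2]
      ring
    have htight' : ∀ i, r i m = 0 → r i (m + -d) = r i m := by
      intro i h0
      have h2 := haff i (-1)
      simp only [neg_smul, one_smul] at h2
      rw [h2, htight i h0, h0]
      ring
    have hdec' : ∃ i, r i (m + -d) < r i m := by
      obtain ⟨i, hi⟩ := hinc
      refine ⟨i, ?_⟩
      have h2 := haff i (-1)
      simp only [neg_smul, one_smul] at h2
      rw [h2]
      linarith
    obtain ⟨t₂, ht₂, hm₂, hcard₂⟩ := exists_step r m (-d) hm haff' htight' hdec'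
    have hΦ₁ : 0 ≤ Φ (m + t₁ • d) := ih _ (hn ▸ hcard₁) _ rfl hm₁
    have hΦ₂ : 0 ≤ Φ (m + t₂ • (-d)) := ih _ (hn ▸ hcard₂) _ rfl hm₂
    rw [hΦ] at hΦ₁
    have hΦneg : Φ (m + t₂ • (-d)) = Φ m - t₂ * (Φ (m + d) - Φ m) := by
      have h1 := hΦ (-t₂)
      have h2 := hΦ (-1)
      simp only [neg_smul, one_smul] at h2
      rw [smul_neg, ← neg_smul, h1]
      ring
    rw [hΦneg] at hΦ₂
    nlinarith

end Summit.CriticalPhenomena.PercolationContinuityZ3.Theorems.SahiE4UnionSegment
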